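/-
Copyright (c) 2026 the pub-hodgecm-mathlib formalisation cell (harness21).  Prover seat hodgecm-mathlib-K2Liu-p10 (g4), Track B «K2-LIT»,
#184♮ = hLiu418 = `stmt-HodgeConjecture-24832`; (σ) endgame organ, SMALL SIDE, S-2c part (c): the Jacobian of a Levi element on the integrated block.  KERNEL: theorems only.
-/
import Summits.HodgeConjecture.HodgeConjecture.Theorems.K2LiuDeltaModelRealFrame      -- ★ I-0 (`reFrame`, `leviAct`)
import Literature.NumberTheory.GelbartRogawski1991.LocalDoubledUnitaryParabolicNorm    -- ★ `normAbs`∕norm bridges (brings `norm_algebraNorm_localRing`)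
import Literature.NumberTheory.Automorphic.LocalRingUnitModulusProduct                 -- ★ `distribHaarChar_eq_normAbs`
import Mathlib.LinearAlgebra.Matrix.ToLin
import HarnessLib

/-!
# Crux `HLiu418`, (σ) small side, S-2c part (c): THE JACOBIAN OF `leviAct_n D` IS `mod_{F_v}(N(det D)) = ∏_{w ∣ v} ‖det D_w‖_w`

Cell `hodgecm-mathlib`, crux item hLiu418 = `stmt-HodgeConjecture-24832`, route of record `HCCMUnconditional`; squad K2 ∕ K2Liu, prover K2Liu-p10 (g4).
THEOREMS ONLY; lane `--supports stmt-HodgeConjecture-24832 --as helper`.  D10 currency of ★ I-0 `(F E c hcδ hδ v n)`.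

★ S-2a∕S-2b (`krFun_zero_leviOp`, `krSection_levi_mul`) produce the factor `(distribHaarChar F_v (det D_m))⁻¹` with `D_m = toMatrix' (leviAct_n D⁻¹)` (★ S-2c (b)); this file evaluates it:
* §1 **`det_leviAct`**: `LinearMap.det (leviAct_n D) = N_{E⊗F_v/F_v}(det D)` (`leviAct D = R ∘ (D·) ∘ R⁻¹`, Mathlib `LinearMap.det_conj` + `LinearMap.det_restrictScalars`);
* §2 **`coe_inv_distribHaarChar_det_leviAct_inv`**: `((distribHaarChar F_v (mk0 (det (toMatrix' (leviAct_n D⁻¹)))))⁻¹ : ℝ) = ∏_{w ∣ v} ‖(det D)_w‖_w`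
  (★ `distribHaarChar_eq_normAbs`, ★ `norm_algebraNorm_localRing`) — with ★ GR `map_detDelta_galInv_mul_det_blkD` (`‖det blkD_w‖ = ‖det_Δ,{c⁻¹w}‖⁻¹`) this is `|det_Δ m|_v⁻¹`,
  the exponent shift `½ + n/2 ↦ −½ + n/2` of V8e's `hSiegS`.

HONEST LABEL: HC_CM is proved only modulo the 7 printed citations (2 remaining named inputs: hLiu418 = stmt-HodgeConjecture-24832, h413 = stmt-HodgeConjecture-24833)
until rung 0 closes; helper, closes no item.
References: [WeilBNT1967] Ch. I §2 (module of an automorphism = module of its determinant); [KudlaRallis1994] §1; [Kudla1994] §3.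
-/

set_option autoImplicit false
set_option linter.dupNamespace false -- the mandated namespace repeats `HodgeConjecture.HodgeConjecture`

noncomputable section

open scoped Matrix NNReal
open NumberField IsDedekindDomain MeasureTheory
open Literature.NumberTheory.GaloisRepresentations Literature.NumberTheory.GaloisRepresentations.IsNonarchimedeanLocalField
open Literature.NumberTheory.Automorphic Literature.NumberTheory.Automorphic.UnitaryGroup
open Summit.HodgeConjecture.HodgeConjecture.Cruxes.HLiu418.K2LiuDeltaModelRealFrame

namespace Summit.HodgeConjecture.HodgeConjecture.Cruxes.HLiu418.K2LiuKRFrameLeviJacobian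

variable (F : Type) [Field F] [NumberField F] (E : Type) [Field E] [NumberField E] [Algebra F E]
  [Algebra.IsQuadraticExtension F E] (c : E ≃ₐ[F] E)
  {δ : E} (hcδ : c δ = -δ) (hδ : δ ≠ 0) (v : HeightOneSpectrum (𝓞 F)) (n : ℕ)

/-! ## §1 The determinant of `leviAct_n D` -/

/-- `leviAct D` is `R ∘ (D·) ∘ R⁻¹` as `F_v`-linear maps. [cite: Kudla1994, §3] -/
theorem toLinearMap_leviAct_eq (D : GL (Fin n) (LocalRing E v)) :
    ((leviAct F E c hcδ hδ v n D : (Fin (n + n) → v.adicCompletion F) ≃ₗ[v.adicCompletion F] (Fin (n + n) → v.adicCompletion F)) :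
        (Fin (n + n) → v.adicCompletion F) →ₗ[v.adicCompletion F] (Fin (n + n) → v.adicCompletion F)) =
      (reFrame F E c hcδ hδ v n : (Fin n → LocalRing E v) →ₗ[v.adicCompletion F] (Fin (n + n) → v.adicCompletion F)) ∘ₗ
        ((Matrix.toLin' D.val).restrictScalars (v.adicCompletion F)) ∘ₗ
        ((reFrame F E c hcδ hδ v n).symm : (Fin (n + n) → v.adicCompletion F) →ₗ[v.adicCompletion F] (Fin n → LocalRing E v)) := by
  apply LinearMap.ext
  intro x
  simp only [LinearMap.coe_comp, Function.comp_apply, LinearEquiv.coe_coe, LinearMap.coe_restrictScalars, Matrix.toLin'_apply]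
  exact leviAct_apply F E c hcδ hδ v n D x

/-- **`det (leviAct_n D) = N_{E⊗F_v/F_v}(det D)`**. [cite: WeilBNT1967, Ch. I §2] -/
theorem det_leviAct (D : GL (Fin n) (LocalRing E v)) :
    LinearMap.det ((leviAct F E c hcδ hδ v n D : (Fin (n + n) → v.adicCompletion F) ≃ₗ[v.adicCompletion F] (Fin (n + n) → v.adicCompletion F)) :
        (Fin (n + n) → v.adicCompletion F) →ₗ[v.adicCompletion F] (Fin (n + n) → v.adicCompletion F)) =
      Algebra.norm (v.adicCompletion F) D.val.det := by
  rw [toLinearMap_leviAct_eq, LinearMap.det_conj, LinearMap.det_restrictScalars, LinearMap.det_toLin']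

/-- … hence for the matrix `D_m = toMatrix' (leviAct_n D)`. [cite: WeilBNT1967, Ch. I §2] -/
theorem det_toMatrix'_leviAct (D : GL (Fin n) (LocalRing E v)) :
    (LinearMap.toMatrix' ((leviAct F E c hcδ hδ v n D : (Fin (n + n) → v.adicCompletion F) ≃ₗ[v.adicCompletion F] (Fin (n + n) → v.adicCompletion F)) :
        (Fin (n + n) → v.adicCompletion F) →ₗ[v.adicCompletion F] (Fin (n + n) → v.adicCompletion F))).det =
      Algebra.norm (v.adicCompletion F) D.val.det := by
  rw [LinearMap.det_toMatrix', det_leviAct]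

omit [NumberField F] [Algebra.IsQuadraticExtension F E] in
/-- the `w`-components of `det D` and `det D⁻¹` have inverse norms. [folklore] -/
theorem norm_det_inv_apply (D : GL (Fin n) (LocalRing E v)) (w : PlacesOver E v) : ‖D⁻¹.val.det w‖ = ‖D.val.det w‖⁻¹ := by
  have h : D.val.det w * D⁻¹.val.det w = 1 := by
    rw [← Pi.mul_apply, ← Matrix.det_mul, ← Units.val_mul, mul_inv_cancel, Units.val_one, Matrix.det_one, Pi.one_apply]
  have hn : ‖D.val.det w‖ * ‖D⁻¹.val.det w‖ = 1 := by rw [← norm_mul, h, norm_one]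
  exact (eq_inv_of_mul_eq_one_right hn)

/-! ## §2 The Jacobian factor of ★ S-2a∕S-2b -/

/-- Mathlib's norm on `F_v` is the normalised absolute value (reproduced to keep imports small). [folklore] -/
private theorem norm_eq_coe_normAbs' (x : v.adicCompletion F) : ‖x‖ = ((normAbs (v.adicCompletion F) x : ℝ≥0) : ℝ) := by
  by_cases hx : x = 0
  · rw [hx, norm_zero, map_zero, NNReal.coe_zero]
  have hv : Valued.v x ≠ 0 := (Valuation.ne_zero_iff _).2 hx
  have hxn : Valued.v x = WithZero.exp (Multiplicative.toAdd (WithZero.unzero hv)) := by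
    rw [WithZero.exp, ofAdd_toAdd, WithZero.coe_unzero]
  rw [FinitePlace.norm_def, WithZeroMulInt.toNNReal_neg_apply _ hv,
    normAbs_eq_inv_zpow_of_valued_eq v hxn, residueFieldCard_adicCompletion_eq, _root_.inv_zpow', neg_neg]
  rfl

/-- **THE JACOBIAN FACTOR**: `((distribHaarChar F_v (det D_m))⁻¹ : ℝ) = ∏_{w ∣ v} ‖(det D)_w‖_w` for `D_m = toMatrix' (leviAct_n D⁻¹)` and ANY proof `h` that `det D_m ≠ 0`.
[cite: WeilBNT1967, Ch. I §2] [cite: KudlaRallis1994, §1] -/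
theorem coe_inv_distribHaarChar_det_leviAct_inv (D : GL (Fin n) (LocalRing E v))
    (h : (LinearMap.toMatrix' ((leviAct F E c hcδ hδ v n D⁻¹ : (Fin (n + n) → v.adicCompletion F) ≃ₗ[v.adicCompletion F] (Fin (n + n) → v.adicCompletion F)) :
        (Fin (n + n) → v.adicCompletion F) →ₗ[v.adicCompletion F] (Fin (n + n) → v.adicCompletion F))).det ≠ 0) :
    (((distribHaarChar (v.adicCompletion F) (Units.mk0 _ h))⁻¹ : ℝ≥0) : ℝ) = ∏ w : PlacesOver E v, ‖D.val.det w‖ := by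
  rw [NNReal.coe_inv, distribHaarChar_eq_normAbs, Units.val_mk0, ← norm_eq_coe_normAbs', det_toMatrix'_leviAct, norm_algebraNorm_localRing, ← Finset.prod_inv_distrib]
  exact Finset.prod_congr rfl fun w _ => by rw [norm_det_inv_apply, inv_inv]

end Summit.HodgeConjecture.HodgeConjecture.Cruxes.HLiu418.K2LiuKRFrameLeviJacobian

end
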